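/-
Copyright (c) 2026 the pub-hodgecm-mathlib formalisation cell (harness21).  Prover seat hodgecm-mathlib-LH4-p15 (g0), req620 Track A «(D-RAM) FOUR-FRAME» squad
(STAGE-1b, row (2) of the piece `f_{T₊}`, the (β₂) road under heir LEAD F0P3a-plan (g21) T20-18 (R-36) «PURE-CELL LEDGER»: rows (L-S1)+(L-S2) ∕ the purity half of
(β₂-P); mechanism LH4-p09 (g9) MECH-beta2H v1 §3 «if the line part led, the cell would be PURE»; refuter evidence LH4-cdis1 (g0) BETA2-CELLCHECK v1 cf94291e), 2026-09-04.
-/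
import Summits.HodgeConjecture.HodgeConjecture.Theorems.F0P3cDyRamGlueLabelPlaneDominated   -- ★ (LH4-p13 (g8)): `setOf_thicken_add_small_eq`; brings ★ p860233 `…BlockGlueValueSet` (`valueSet_endoGL_sub_one_glued_eq_plane`, `latticeValueSetMod_…`), ★ census DEFS
import Summits.HodgeConjecture.HodgeConjecture.Theorems.F0P3cDyRamConeCellFaceAxis            -- ★ p861154 (this seat): `image_mul_valueSetMod_smul_xPlus`; brings ★ (L-lab-3) `valueSetMod_smul_xPlus`, ★ `valueSetMod_smul_xPlus_mul_norm`, ★ `refSkewScalar_ne_zero`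
import HarnessLib

/-!
# Crux `H413`, line LH4 «(D-RAM) FOUR-FRAME» — STAGE-1b, row (2), the (β₂) road (R-36): «LINE-DOMINATED GLUED VERTICES ARE PURE» — when the PLANE part of ★ p860233's glue
# value is `ϖ^m`-small, the census value set of `Γ − 1` on the vertex is `valueSetMod σ ϖ m (e • X₊)` with `e·t₊ = (u − 1)·h·N(x₀ 1)`: ONE class for the whole cell

Cell `hodgecm-mathlib` (D-0151), FLOOR 0, crux item H413 = `stmt-HodgeConjecture-24833`, route of record `HCCMUnconditional`; squad F0∕P3c∕LH4; lane
`--supports stmt-HodgeConjecture-24833 --as helper` (count-neutral; pays NO tier-0 row).  THEOREMS ONLY (no `def`, no instance, no notation, no `sorry`, default heartbeats);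
★-only imports; states NO law; (β₂) stays a HYPOTHESIS.  DATUM-FREE lattice algebra (`K` valued, `σ` any ring endomorphism — isometric where said —, `|ϖ| = exp(−1)`, block form
`H = !![H₂ 0 0, 0, H₂ 0 1; 0, h, 0; H₂ 1 0, 0, H₂ 1 1]`, block element `Γ = endoGL (γ₂, u)`; no residue field, no `|2|`, no self-duality).

WHY (heir LEAD T20-18 (R-36); LH4-cdis1 (g0) FINDING #1; LH4-p09 (g9) MECH-beta2H §3).  The refuter's pure cells all sit on ONE glue layer: `a₂ = v_E(u − 1) − ℓ₀` (U: `D, S₁, S₂` at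
`a₂ = ρ₁₃ = v_E(u−1)`; RamM: `D, K₀` at `a₂ = ρ₁₃ − 1`), i.e. exactly where the LINE TERM `(u − 1)·h·N(a·x₀ 1)` of ★ p860233's glue value (`|x₀ 1| = |ϖ|^{−b}`) is a UNIT multiple
of the reference skew scalar `t₊`.  This file is the TWIN of ★ `F0P3cDyRamGlueLabelPlaneDominated` (LH4-p13 (g8)) with the roles of plane and line swapped:
* §1 `glueSet_eq_lineSet_of_plane_small` — in the plane letters of ★ `valueSet_endoGL_sub_one_glued_eq_plane`, if the PLANE part `⟨β′, (γ₂ − u)β′⟩_{H₂} + (u − 1)⟨β′, β′⟩_{H₂}` is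
  `ϖ^m`-small on `B₂ + 𝒪·w₀`, the thickened glue set is the thickened LINE set `{(u − 1)·σ(a·x₀ 1)·h·(a·x₀ 1) ∣ |a| ≤ 1}` (★ `setOf_thicken_add_small_eq`).
* §2 `lineSet_eq_valueSetMod_smul_xPlus` — the thickened line set IS `valueSetMod σ ϖ m (e • X₊)`, `e := (u − 1)·(σ(x₀ 1)·h·x₀ 1)·t₊⁻¹` (★ (L-lab-3) `valueSetMod_smul_xPlus`).
* §3 HEADS `valueSet_glued_eq_smul_xPlus_of_plane_small` (general `(H₂, h)` — the `VS_H` letters of LH4-p04 (g8)'s (S4-cells) §1) and, at `(antidiag₂, 1)`, the census letter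
  `latticeValueSetMod_glued_eq_smul_xPlus_of_plane_small` (★ DEFS `latticeValueSetMod σ ϖ m M (Γ − 1) = valueSetMod σ ϖ m (e • X₊)`).
* §4 PURITY — `valueSet_glued_eq_of_plane_small`: two line-dominated glued vertices with the same `(γ₂, u, h, b)` (ANY plane data `(B₂, w₀)`, `(B₂′, w₀′)`) have the SAME
  census letter (`e′ = e·N(x₀′ 1 ∕ x₀ 1)`, a unit norm — ★ `valueSetMod_smul_xPlus_mul_norm`); hence the same label (`latticeLabelPlus_glued_iff_of_plane_small`): the cell is
  PURE — the «FLIP = 0, label constant» half of (β₂-P) as a theorem.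
* §5 THE LINE COEFFICIENT MOVES THE LETTER — `valueSet_glued_eq_image_mul_of_plane_small`: replacing `h` by `c·h` (`|c| = 1`) multiplies the letter by `c`
  (★ p861154 `image_mul_valueSetMod_smul_xPlus`); with ★ p861154 §2 a `σ`-fixed NON-norm `c` EXCHANGES the classes `+ ↔ −′` — the sign law `s(lit₂) = −s(lit₁)` of the
  diagonal cell `D` in (β₂-L) when the two literals' line coefficients differ by a non-norm.
WHAT IS NOT CLAIMED: which cells ARE line-dominated (the instance `hplane` on `D ∕ S₁ ∕ S₂ ∕ K₀` is the cell geometry of the board rows), the sizes `2^{ρ₁₃+j}`, the sign of `e`.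
HONEST LABEL.  Count-neutral; nothing printed is asserted; no census law is stated; `HC_CM` is proved only modulo the 7 printed citations (2 remaining named inputs: hLiu418 =
`stmt-HodgeConjecture-24832`, h413 = `stmt-HodgeConjecture-24833`) until rung 0 closes.
## References
* [Jacobowitz1962] R. Jacobowitz, *Hermitian forms over local fields*, Amer. J. Math. 84 (1962): §4 (dual lattices, modular components, gluing).
* [Rogawski1990] J. D. Rogawski, *Automorphic Representations of Unitary Groups in Three Variables*, Ann. of Math. Stud. 123 (1990): §4.9 Prop. 4.9.1 (b) p. 55 (the labelled census of `f_{T₊}`).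
* [Kottwitz1986BaseChangeUnits] R. E. Kottwitz, *Base change for unit elements of Hecke algebras*, Compositio Math. 60 (1986): §1 pp. 240–241.
* [Serre1979] J.-P. Serre, *Local Fields*, GTM 67 (1979): Ch. V §3 Cor. 3 (norm classes of units).
-/

set_option autoImplicit false

noncomputable section

namespace Summit.HodgeConjecture.HodgeConjecture.Cruxes.H413.F0P3cDyRamGlueLabelLineDominated

open scoped Valued WithZero Matrix MatrixGroups
open WithZero
open Literature.NumberTheory.Automorphic Literature.NumberTheory.Automorphic.HermitianLattice Literature.NumberTheory.Automorphic.UnitaryLatticeTree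
open Literature.NumberTheory.Rogawski1990
open Literature.NumberTheory.LocalFields.WildQuadraticDatum (refSkewScalar_ne_zero)
open Summit.HodgeConjecture.HodgeConjecture.Cruxes.H413.F0P3cDyRamFourFramePieces
open Summit.HodgeConjecture.HodgeConjecture.Cruxes.H413.F0P3cDyRamFourFrameCensusDefs (latticeValueSetMod LatticeLabelPlus)
open Summit.HodgeConjecture.HodgeConjecture.Cruxes.H413.F0P3cDyRamBlockGlueValueSet
open Summit.HodgeConjecture.HodgeConjecture.Cruxes.H413.F0P3cDyRamGlueLabelPlaneDominated (setOf_thicken_add_small_eq)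
open Summit.HodgeConjecture.HodgeConjecture.Cruxes.H413.F0P3cDyRamSmulXPlusLabel (valueSetMod_smul_xPlus)
open Summit.HodgeConjecture.HodgeConjecture.Cruxes.H413.F0P3cDyRamFrameEltOneSlotLabel (valueSetMod_smul_xPlus_mul_norm)
open Summit.HodgeConjecture.HodgeConjecture.Cruxes.H413.F0P3cDyRamConeCellFaceAxis (image_mul_valueSetMod_smul_xPlus)

variable {K : Type} [Field K] [Valued K ℤᵐ⁰]

/-! ## §1 The glue set with the PLANE part dropped -/

/-- **THE GLUE SET OF A LINE-DOMINATED VERTEX IS ITS LINE SET.**  In the plane letters of ★ `valueSet_endoGL_sub_one_glued_eq_plane` (any `H₂, h, γ₂, u, B₂, w₀`, glue scalar `t`):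
if the PLANE part `⟨β′, (γ₂ − u)β′⟩_{H₂} + (u − 1)·⟨β′, β′⟩_{H₂}` (`β′ = β + a·w₀`) is `ϖ^m`-small for all `β ∈ B₂`, `|a| ≤ 1`, then the `ϖ^m`-thickened set of values
`⟨β′, (γ₂ − u)β′⟩ + (u − 1)(⟨β′, β′⟩ + σ(a t)·h·(a t))` is the `ϖ^m`-thickened set of LINE values `(u − 1)·σ(a t)·h·(a t)`. [cite: Jacobowitz1962, §4] [cite: Rogawski1990, §4.9 Prop. 4.9.1 (b) p. 55] -/
theorem glueSet_eq_lineSet_of_plane_small (σ : K →+* K) (H₂ : Matrix (Fin 2) (Fin 2) K) (h : K) (ϖ : K) (m : ℕ) (B₂ : Submodule 𝒪[K] (Fin 2 → K)) (w₀ : Fin 2 → K) (t : K)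
    (γ₂ : GL (Fin 2) K) (u : GL (Fin 1) K)
    (hplane : ∀ β ∈ B₂, ∀ a : K, Valued.v a ≤ 1 →
      Valued.v ((ϖ ^ m)⁻¹ * (pairing σ H₂ (β + a • w₀) ((((γ₂ : Matrix (Fin 2) (Fin 2) K) - (u : Matrix (Fin 1) (Fin 1) K) 0 0 • (1 : Matrix (Fin 2) (Fin 2) K))) *ᵥ (β + a • w₀)) +
        ((u : Matrix (Fin 1) (Fin 1) K) 0 0 - 1) * pairing σ H₂ (β + a • w₀) (β + a • w₀))) ≤ 1) :
    {z : K | ∃ β ∈ B₂, ∃ a : K, Valued.v a ≤ 1 ∧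
        Valued.v ((ϖ ^ m)⁻¹ * (z - (pairing σ H₂ (β + a • w₀) ((((γ₂ : Matrix (Fin 2) (Fin 2) K) - (u : Matrix (Fin 1) (Fin 1) K) 0 0 • (1 : Matrix (Fin 2) (Fin 2) K))) *ᵥ (β + a • w₀)) +
          ((u : Matrix (Fin 1) (Fin 1) K) 0 0 - 1) * (pairing σ H₂ (β + a • w₀) (β + a • w₀) + σ (a * t) * h * (a * t))))) ≤ 1} =
      {z : K | ∃ β ∈ B₂, ∃ a : K, Valued.v a ≤ 1 ∧ Valued.v ((ϖ ^ m)⁻¹ * (z - ((u : Matrix (Fin 1) (Fin 1) K) 0 0 - 1) * (σ (a * t) * h * (a * t)))) ≤ 1} := by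
  have e1 : ∀ (β : Fin 2 → K) (a : K) (z : K),
      (ϖ ^ m)⁻¹ * (z - (pairing σ H₂ (β + a • w₀) ((((γ₂ : Matrix (Fin 2) (Fin 2) K) - (u : Matrix (Fin 1) (Fin 1) K) 0 0 • (1 : Matrix (Fin 2) (Fin 2) K))) *ᵥ (β + a • w₀)) +
          ((u : Matrix (Fin 1) (Fin 1) K) 0 0 - 1) * (pairing σ H₂ (β + a • w₀) (β + a • w₀) + σ (a * t) * h * (a * t)))) =
      (ϖ ^ m)⁻¹ * (z - (((u : Matrix (Fin 1) (Fin 1) K) 0 0 - 1) * (σ (a * t) * h * (a * t)) +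
        (pairing σ H₂ (β + a • w₀) ((((γ₂ : Matrix (Fin 2) (Fin 2) K) - (u : Matrix (Fin 1) (Fin 1) K) 0 0 • (1 : Matrix (Fin 2) (Fin 2) K))) *ᵥ (β + a • w₀)) +
          ((u : Matrix (Fin 1) (Fin 1) K) 0 0 - 1) * pairing σ H₂ (β + a • w₀) (β + a • w₀)))) := fun β a z => by ring
  simp only [e1]
  exact setOf_thicken_add_small_eq ϖ m B₂ (fun _ a => ((u : Matrix (Fin 1) (Fin 1) K) 0 0 - 1) * (σ (a * t) * h * (a * t)))
    (fun β a => pairing σ H₂ (β + a • w₀) ((((γ₂ : Matrix (Fin 2) (Fin 2) K) - (u : Matrix (Fin 1) (Fin 1) K) 0 0 • (1 : Matrix (Fin 2) (Fin 2) K))) *ᵥ (β + a • w₀)) +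
      ((u : Matrix (Fin 1) (Fin 1) K) 0 0 - 1) * pairing σ H₂ (β + a • w₀) (β + a • w₀)) hplane

/-! ## §2 The thickened LINE set is the value set of a scalar multiple of the reference nilpotent -/

/-- **THE LINE SET IS `valueSetMod σ ϖ m (e • X₊)` WITH `e·t₊ = c·σ(t)·h·t`** (`t₊ = (ϖ − σϖ)·((ϖσϖ)^{⌊d∕2⌋})⁻¹ ≠ 0`; `B₂ ∋ 0` makes the idle `β`-quantifier harmless):
`{z ∣ ∃ β ∈ B₂, ∃ a, |a| ≤ 1 ∧ |(ϖ^m)⁻¹(z − c·σ(a t)·h·(a t))| ≤ 1} = valueSetMod σ ϖ m ((c·(σt·h·t)·t₊⁻¹) • X₊)` (★ (L-lab-3) `valueSetMod_smul_xPlus`: members `e·t₊·N(a)`).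
[cite: Rogawski1990, §4.9 Prop. 4.9.1 (b) p. 55] -/
theorem lineSet_eq_valueSetMod_smul_xPlus {σ : K →+* K} (hvσ : ∀ a, Valued.v (σ a) = Valued.v a) {ϖ : K} (hϖ : Valued.v ϖ = exp (-1 : ℤ)) {d : ℕ}
    (hd : Valued.v (ϖ - σ ϖ) = Valued.v ϖ ^ d) (m : ℕ) (B₂ : Submodule 𝒪[K] (Fin 2 → K)) (c h t : K) :
    {z : K | ∃ β ∈ B₂, ∃ a : K, Valued.v a ≤ 1 ∧ Valued.v ((ϖ ^ m)⁻¹ * (z - c * (σ (a * t) * h * (a * t)))) ≤ 1} =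
      valueSetMod σ ϖ m ((c * (σ t * h * t) * ((ϖ - σ ϖ) * ((ϖ * σ ϖ) ^ ((d - d % 2) / 2))⁻¹)⁻¹) • xPlus σ ϖ d) := by
  have ht0 := refSkewScalar_ne_zero hvσ hϖ hd
  have key : ∀ a : K, c * (σ (a * t) * h * (a * t)) =
      c * (σ t * h * t) * ((ϖ - σ ϖ) * ((ϖ * σ ϖ) ^ ((d - d % 2) / 2))⁻¹)⁻¹ * ((ϖ - σ ϖ) * ((ϖ * σ ϖ) ^ ((d - d % 2) / 2))⁻¹ * (a * σ a)) := fun a => by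
    rw [map_mul, mul_assoc (c * (σ t * h * t)), ← mul_assoc ((ϖ - σ ϖ) * ((ϖ * σ ϖ) ^ ((d - d % 2) / 2))⁻¹)⁻¹, inv_mul_cancel₀ ht0, one_mul]
    ring
  rw [valueSetMod_smul_xPlus]
  ext z
  simp only [Set.mem_setOf_eq, key]
  constructor
  · rintro ⟨-, -, a, ha, hz⟩
    exact ⟨a, ha, hz⟩
  · rintro ⟨a, ha, hz⟩
    exact ⟨0, B₂.zero_mem, a, ha, hz⟩

/-! ## §3 HEADS — the census letter of a line-dominated glued vertex -/

/-- **THE VALUE SET OF `Γ − 1` ON A LINE-DOMINATED GLUED VERTEX, GENERAL BLOCK FORM `(H₂, h)`** (the `VS_H` letters of the (S4-cells) decomposition).  In ★ p860233's glue letters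
(`hpr, hB, hx₀, hx₀1, hprx`), if the plane part is `ϖ^m`-small on `B₂ + 𝒪·w₀` (`hplane`), then
`{z ∣ ∃ y ∈ M, |(ϖ^m)⁻¹(z − ⟨y, (Γ − 1)y⟩_H)| ≤ 1} = valueSetMod σ ϖ m (e • X₊)`, `e = (u₀₀ − 1)·(σ(x₀ 1)·h·x₀ 1)·t₊⁻¹` — the LINE TERM decides the letter.
[cite: Jacobowitz1962, §4] [cite: Rogawski1990, §4.9 Prop. 4.9.1 (b) p. 55] [cite: Kottwitz1986BaseChangeUnits, §1 pp. 240–241] -/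
theorem valueSet_glued_eq_smul_xPlus_of_plane_small {σ : K →+* K} (hvσ : ∀ a, Valued.v (σ a) = Valued.v a) {ϖ : K} (hϖ : Valued.v ϖ = exp (-1 : ℤ)) {d : ℕ}
    (hd : Valued.v (ϖ - σ ϖ) = Valued.v ϖ ^ d) (H₂ : Matrix (Fin 2) (Fin 2) K) (h : K)
    {M : Submodule 𝒪[K] (Fin 3 → K)} {b : ℕ} (hpr : ∀ x ∈ M, Valued.v (x 1) * Valued.v ϖ ^ b ≤ 1)
    {B₂ : Submodule 𝒪[K] (Fin 2 → K)} {w₀ : Fin 2 → K} {x₀ : Fin 3 → K}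
    (hB : B₂.map ((Matrix.toLin' (!![1, 0; 0, 0; 0, 1] : Matrix (Fin 3) (Fin 2) K)).restrictScalars 𝒪[K]) =
      M ⊓ LinearMap.ker ((LinearMap.proj (1 : Fin 3) : (Fin 3 → K) →ₗ[K] K).restrictScalars 𝒪[K]))
    (hx₀ : x₀ ∈ M) (hx₀1 : Valued.v (x₀ 1) * Valued.v ϖ ^ b = 1) (hprx : x₀ - Pi.single 1 (x₀ 1) = ![w₀ 0, 0, w₀ 1])
    (γ₂ : GL (Fin 2) K) (u : GL (Fin 1) K) (m : ℕ)
    (hplane : ∀ β ∈ B₂, ∀ a : K, Valued.v a ≤ 1 →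
      Valued.v ((ϖ ^ m)⁻¹ * (pairing σ H₂ (β + a • w₀) ((((γ₂ : Matrix (Fin 2) (Fin 2) K) - (u : Matrix (Fin 1) (Fin 1) K) 0 0 • (1 : Matrix (Fin 2) (Fin 2) K))) *ᵥ (β + a • w₀)) +
        ((u : Matrix (Fin 1) (Fin 1) K) 0 0 - 1) * pairing σ H₂ (β + a • w₀) (β + a • w₀))) ≤ 1) :
    {z : K | ∃ y ∈ M, Valued.v ((ϖ ^ m)⁻¹ * (z - pairing σ (!![H₂ 0 0, 0, H₂ 0 1; 0, h, 0; H₂ 1 0, 0, H₂ 1 1] : Matrix (Fin 3) (Fin 3) K) y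
        ((((endoGL (γ₂, u) : GL (Fin 3) K) : Matrix (Fin 3) (Fin 3) K) - 1) *ᵥ y))) ≤ 1} =
      valueSetMod σ ϖ m ((((u : Matrix (Fin 1) (Fin 1) K) 0 0 - 1) * (σ (x₀ 1) * h * x₀ 1) * ((ϖ - σ ϖ) * ((ϖ * σ ϖ) ^ ((d - d % 2) / 2))⁻¹)⁻¹) • xPlus σ ϖ d) := by
  rw [valueSet_endoGL_sub_one_glued_eq_plane σ hϖ H₂ h hpr hB hx₀ hx₀1 hprx γ₂ u m, glueSet_eq_lineSet_of_plane_small σ H₂ h ϖ m B₂ w₀ (x₀ 1) γ₂ u hplane]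
  exact lineSet_eq_valueSetMod_smul_xPlus hvσ hϖ hd m B₂ _ h (x₀ 1)

/-- **THE CENSUS LETTER OF A LINE-DOMINATED GLUED VERTEX** (`Φ₃ = block(antidiag₂, 1)`, ★ p860233 §4): ★ census DEFS `latticeValueSetMod σ ϖ m M (Γ − 1) = valueSetMod σ ϖ m (e • X₊)`,
`e = (u₀₀ − 1)·(σ(x₀ 1)·1·x₀ 1)·t₊⁻¹`, whenever the plane part is `ϖ^m`-small on `B₂ + 𝒪·w₀`. [cite: Rogawski1990, §4.9 Prop. 4.9.1 (b) p. 55] [cite: Jacobowitz1962, §4] -/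
theorem latticeValueSetMod_glued_eq_smul_xPlus_of_plane_small {σ : K →+* K} (hvσ : ∀ a, Valued.v (σ a) = Valued.v a) {ϖ : K} (hϖ : Valued.v ϖ = exp (-1 : ℤ)) {d : ℕ}
    (hd : Valued.v (ϖ - σ ϖ) = Valued.v ϖ ^ d)
    {M : Submodule 𝒪[K] (Fin 3 → K)} {b : ℕ} (hpr : ∀ x ∈ M, Valued.v (x 1) * Valued.v ϖ ^ b ≤ 1)
    {B₂ : Submodule 𝒪[K] (Fin 2 → K)} {w₀ : Fin 2 → K} {x₀ : Fin 3 → K}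
    (hB : B₂.map ((Matrix.toLin' (!![1, 0; 0, 0; 0, 1] : Matrix (Fin 3) (Fin 2) K)).restrictScalars 𝒪[K]) =
      M ⊓ LinearMap.ker ((LinearMap.proj (1 : Fin 3) : (Fin 3 → K) →ₗ[K] K).restrictScalars 𝒪[K]))
    (hx₀ : x₀ ∈ M) (hx₀1 : Valued.v (x₀ 1) * Valued.v ϖ ^ b = 1) (hprx : x₀ - Pi.single 1 (x₀ 1) = ![w₀ 0, 0, w₀ 1])
    (γ₂ : GL (Fin 2) K) (u : GL (Fin 1) K) (m : ℕ)
    (hplane : ∀ β ∈ B₂, ∀ a : K, Valued.v a ≤ 1 →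
      Valued.v ((ϖ ^ m)⁻¹ * (pairing σ ((StdForm.antidiagonal 2).over K) (β + a • w₀) ((((γ₂ : Matrix (Fin 2) (Fin 2) K) - (u : Matrix (Fin 1) (Fin 1) K) 0 0 • (1 : Matrix (Fin 2) (Fin 2) K))) *ᵥ (β + a • w₀)) +
        ((u : Matrix (Fin 1) (Fin 1) K) 0 0 - 1) * pairing σ ((StdForm.antidiagonal 2).over K) (β + a • w₀) (β + a • w₀))) ≤ 1) :
    latticeValueSetMod σ ϖ m M (((endoGL (γ₂, u) : GL (Fin 3) K) : Matrix (Fin 3) (Fin 3) K) - 1) =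
      valueSetMod σ ϖ m ((((u : Matrix (Fin 1) (Fin 1) K) 0 0 - 1) * (σ (x₀ 1) * 1 * x₀ 1) * ((ϖ - σ ϖ) * ((ϖ * σ ϖ) ^ ((d - d % 2) / 2))⁻¹)⁻¹) • xPlus σ ϖ d) := by
  rw [latticeValueSetMod_endoGL_sub_one_glued_eq_plane σ hϖ hpr hB hx₀ hx₀1 hprx γ₂ u m,
    glueSet_eq_lineSet_of_plane_small σ _ 1 ϖ m B₂ w₀ (x₀ 1) γ₂ u hplane]
  exact lineSet_eq_valueSetMod_smul_xPlus hvσ hϖ hd m B₂ _ 1 (x₀ 1)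

/-! ## §4 PURITY — on a line-dominated cell the census letter, hence the label, is the same at every vertex -/

/-- **THE LINE SCALAR MOVES BY A UNIT NORM ALONG THE CELL**: two glue scalars of the same tube level (`|x₀ 1|·|ϖ|^b = 1 = |x₀′ 1|·|ϖ|^b`) give line scalars in ONE norm class:
`valueSetMod σ ϖ m ((c·(σ(x₀′1)·h·x₀′1)·s) • X₊) = valueSetMod σ ϖ m ((c·(σ(x₀1)·h·x₀1)·s) • X₊)` (`z = x₀′ 1 ∕ x₀ 1` is a unit and the scalars differ by `z·σz`; ★ `…_mul_norm`).
[cite: Serre1979, Ch. V §3 Cor. 3] [cite: Rogawski1990, §4.9 Prop. 4.9.1 (b) p. 55] -/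
theorem valueSetMod_lineScalar_eq_of_v_eq (σ : K →+* K) (ϖ : K) (d m : ℕ) (c h s : K) {b : ℕ} {t t' : K}
    (ht : Valued.v t * Valued.v ϖ ^ b = 1) (ht' : Valued.v t' * Valued.v ϖ ^ b = 1) :
    valueSetMod σ ϖ m ((c * (σ t' * h * t') * s) • xPlus σ ϖ d) = valueSetMod σ ϖ m ((c * (σ t * h * t) * s) • xPlus σ ϖ d) := by
  have hvt0 : Valued.v t ≠ 0 := fun h0 => by rw [h0, zero_mul] at ht; exact zero_ne_one ht
  have ht0 : t ≠ 0 := fun h0 => by rw [h0, map_zero] at hvt0; exact hvt0 rfl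
  have hz1 : Valued.v (t' / t) = 1 := by
    rw [map_div₀]
    have : Valued.v t' = Valued.v t := by
      have hpow : Valued.v ϖ ^ b ≠ 0 := fun h0 => by rw [h0, mul_zero] at ht; exact zero_ne_one ht
      exact mul_right_cancel₀ hpow (ht'.trans ht.symm)
    rw [this, div_self hvt0]
  have e : c * (σ t' * h * t') * s = c * (σ t * h * t) * s * ((t' / t) * σ (t' / t)) := by
    rw [map_div₀]
    have hσt0 : σ t ≠ 0 := (map_ne_zero σ).2 ht0
    field_simp
  rw [e, valueSetMod_smul_xPlus_mul_norm σ ϖ d m _ hz1]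

/-- **PURITY OF A LINE-DOMINATED CELL (general block form).**  Two glued vertices `M` (over `(B₂, w₀, x₀)`) and `M′` (over `(B₂′, w₀′, x₀′)`) of the SAME `Γ = endoGL (γ₂, u)`, the same
form `(H₂, h)` and the same tube level `b`, BOTH line-dominated (`hplane`, `hplane′`), have THE SAME thickened value set of `Γ − 1` — whatever the plane data: the set is
`valueSetMod σ ϖ m (e • X₊)` with `e` depending on the vertex only through `N(x₀ 1)`, which moves by unit norms.  The «FLIP = 0, label constant» half of (β₂-P).
[cite: Jacobowitz1962, §4] [cite: Rogawski1990, §4.9 Prop. 4.9.1 (b) p. 55] [cite: Serre1979, Ch. V §3 Cor. 3] -/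
theorem valueSet_glued_eq_of_plane_small {σ : K →+* K} (hvσ : ∀ a, Valued.v (σ a) = Valued.v a) {ϖ : K} (hϖ : Valued.v ϖ = exp (-1 : ℤ)) {d : ℕ}
    (hd : Valued.v (ϖ - σ ϖ) = Valued.v ϖ ^ d) (H₂ : Matrix (Fin 2) (Fin 2) K) (h : K)
    {M M' : Submodule 𝒪[K] (Fin 3 → K)} {b : ℕ} (hpr : ∀ x ∈ M, Valued.v (x 1) * Valued.v ϖ ^ b ≤ 1) (hpr' : ∀ x ∈ M', Valued.v (x 1) * Valued.v ϖ ^ b ≤ 1)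
    {B₂ B₂' : Submodule 𝒪[K] (Fin 2 → K)} {w₀ w₀' : Fin 2 → K} {x₀ x₀' : Fin 3 → K}
    (hB : B₂.map ((Matrix.toLin' (!![1, 0; 0, 0; 0, 1] : Matrix (Fin 3) (Fin 2) K)).restrictScalars 𝒪[K]) =
      M ⊓ LinearMap.ker ((LinearMap.proj (1 : Fin 3) : (Fin 3 → K) →ₗ[K] K).restrictScalars 𝒪[K]))
    (hB' : B₂'.map ((Matrix.toLin' (!![1, 0; 0, 0; 0, 1] : Matrix (Fin 3) (Fin 2) K)).restrictScalars 𝒪[K]) =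
      M' ⊓ LinearMap.ker ((LinearMap.proj (1 : Fin 3) : (Fin 3 → K) →ₗ[K] K).restrictScalars 𝒪[K]))
    (hx₀ : x₀ ∈ M) (hx₀' : x₀' ∈ M') (hx₀1 : Valued.v (x₀ 1) * Valued.v ϖ ^ b = 1) (hx₀'1 : Valued.v (x₀' 1) * Valued.v ϖ ^ b = 1)
    (hprx : x₀ - Pi.single 1 (x₀ 1) = ![w₀ 0, 0, w₀ 1]) (hprx' : x₀' - Pi.single 1 (x₀' 1) = ![w₀' 0, 0, w₀' 1])
    (γ₂ : GL (Fin 2) K) (u : GL (Fin 1) K) (m : ℕ)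
    (hplane : ∀ β ∈ B₂, ∀ a : K, Valued.v a ≤ 1 →
      Valued.v ((ϖ ^ m)⁻¹ * (pairing σ H₂ (β + a • w₀) ((((γ₂ : Matrix (Fin 2) (Fin 2) K) - (u : Matrix (Fin 1) (Fin 1) K) 0 0 • (1 : Matrix (Fin 2) (Fin 2) K))) *ᵥ (β + a • w₀)) +
        ((u : Matrix (Fin 1) (Fin 1) K) 0 0 - 1) * pairing σ H₂ (β + a • w₀) (β + a • w₀))) ≤ 1)
    (hplane' : ∀ β ∈ B₂', ∀ a : K, Valued.v a ≤ 1 →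
      Valued.v ((ϖ ^ m)⁻¹ * (pairing σ H₂ (β + a • w₀') ((((γ₂ : Matrix (Fin 2) (Fin 2) K) - (u : Matrix (Fin 1) (Fin 1) K) 0 0 • (1 : Matrix (Fin 2) (Fin 2) K))) *ᵥ (β + a • w₀')) +
        ((u : Matrix (Fin 1) (Fin 1) K) 0 0 - 1) * pairing σ H₂ (β + a • w₀') (β + a • w₀'))) ≤ 1) :
    {z : K | ∃ y ∈ M, Valued.v ((ϖ ^ m)⁻¹ * (z - pairing σ (!![H₂ 0 0, 0, H₂ 0 1; 0, h, 0; H₂ 1 0, 0, H₂ 1 1] : Matrix (Fin 3) (Fin 3) K) y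
        ((((endoGL (γ₂, u) : GL (Fin 3) K) : Matrix (Fin 3) (Fin 3) K) - 1) *ᵥ y))) ≤ 1} =
      {z : K | ∃ y ∈ M', Valued.v ((ϖ ^ m)⁻¹ * (z - pairing σ (!![H₂ 0 0, 0, H₂ 0 1; 0, h, 0; H₂ 1 0, 0, H₂ 1 1] : Matrix (Fin 3) (Fin 3) K) y
        ((((endoGL (γ₂, u) : GL (Fin 3) K) : Matrix (Fin 3) (Fin 3) K) - 1) *ᵥ y))) ≤ 1} := by
  rw [valueSet_glued_eq_smul_xPlus_of_plane_small hvσ hϖ hd H₂ h hpr hB hx₀ hx₀1 hprx γ₂ u m hplane,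
    valueSet_glued_eq_smul_xPlus_of_plane_small hvσ hϖ hd H₂ h hpr' hB' hx₀' hx₀'1 hprx' γ₂ u m hplane']
  exact (valueSetMod_lineScalar_eq_of_v_eq σ ϖ d m _ h _ hx₀1 hx₀'1).symm

/-- **THE LABEL IS CONSTANT ON A LINE-DOMINATED CELL** (`Φ₃ = block(antidiag₂, 1)`): two line-dominated glued vertices of the same `Γ` and tube level carry the same transvection
label `LatticeLabelPlus σ ϖ d m · (Γ − 1)` — a cell all of whose vertices are line-dominated is PURE. [cite: Rogawski1990, §4.9 Prop. 4.9.1 (b) p. 55] [cite: Serre1979, Ch. V §3 Cor. 3] -/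
theorem latticeLabelPlus_glued_iff_of_plane_small {σ : K →+* K} (hvσ : ∀ a, Valued.v (σ a) = Valued.v a) {ϖ : K} (hϖ : Valued.v ϖ = exp (-1 : ℤ)) {d : ℕ}
    (hd : Valued.v (ϖ - σ ϖ) = Valued.v ϖ ^ d)
    {M M' : Submodule 𝒪[K] (Fin 3 → K)} {b : ℕ} (hpr : ∀ x ∈ M, Valued.v (x 1) * Valued.v ϖ ^ b ≤ 1) (hpr' : ∀ x ∈ M', Valued.v (x 1) * Valued.v ϖ ^ b ≤ 1)
    {B₂ B₂' : Submodule 𝒪[K] (Fin 2 → K)} {w₀ w₀' : Fin 2 → K} {x₀ x₀' : Fin 3 → K}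
    (hB : B₂.map ((Matrix.toLin' (!![1, 0; 0, 0; 0, 1] : Matrix (Fin 3) (Fin 2) K)).restrictScalars 𝒪[K]) =
      M ⊓ LinearMap.ker ((LinearMap.proj (1 : Fin 3) : (Fin 3 → K) →ₗ[K] K).restrictScalars 𝒪[K]))
    (hB' : B₂'.map ((Matrix.toLin' (!![1, 0; 0, 0; 0, 1] : Matrix (Fin 3) (Fin 2) K)).restrictScalars 𝒪[K]) =
      M' ⊓ LinearMap.ker ((LinearMap.proj (1 : Fin 3) : (Fin 3 → K) →ₗ[K] K).restrictScalars 𝒪[K]))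
    (hx₀ : x₀ ∈ M) (hx₀' : x₀' ∈ M') (hx₀1 : Valued.v (x₀ 1) * Valued.v ϖ ^ b = 1) (hx₀'1 : Valued.v (x₀' 1) * Valued.v ϖ ^ b = 1)
    (hprx : x₀ - Pi.single 1 (x₀ 1) = ![w₀ 0, 0, w₀ 1]) (hprx' : x₀' - Pi.single 1 (x₀' 1) = ![w₀' 0, 0, w₀' 1])
    (γ₂ : GL (Fin 2) K) (u : GL (Fin 1) K) (m : ℕ)
    (hplane : ∀ β ∈ B₂, ∀ a : K, Valued.v a ≤ 1 →
      Valued.v ((ϖ ^ m)⁻¹ * (pairing σ ((StdForm.antidiagonal 2).over K) (β + a • w₀) ((((γ₂ : Matrix (Fin 2) (Fin 2) K) - (u : Matrix (Fin 1) (Fin 1) K) 0 0 • (1 : Matrix (Fin 2) (Fin 2) K))) *ᵥ (β + a • w₀)) +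
        ((u : Matrix (Fin 1) (Fin 1) K) 0 0 - 1) * pairing σ ((StdForm.antidiagonal 2).over K) (β + a • w₀) (β + a • w₀))) ≤ 1)
    (hplane' : ∀ β ∈ B₂', ∀ a : K, Valued.v a ≤ 1 →
      Valued.v ((ϖ ^ m)⁻¹ * (pairing σ ((StdForm.antidiagonal 2).over K) (β + a • w₀') ((((γ₂ : Matrix (Fin 2) (Fin 2) K) - (u : Matrix (Fin 1) (Fin 1) K) 0 0 • (1 : Matrix (Fin 2) (Fin 2) K))) *ᵥ (β + a • w₀')) +
        ((u : Matrix (Fin 1) (Fin 1) K) 0 0 - 1) * pairing σ ((StdForm.antidiagonal 2).over K) (β + a • w₀') (β + a • w₀'))) ≤ 1) :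
    LatticeLabelPlus σ ϖ d m M (((endoGL (γ₂, u) : GL (Fin 3) K) : Matrix (Fin 3) (Fin 3) K) - 1) ↔
      LatticeLabelPlus σ ϖ d m M' (((endoGL (γ₂, u) : GL (Fin 3) K) : Matrix (Fin 3) (Fin 3) K) - 1) := by
  unfold LatticeLabelPlus
  rw [latticeValueSetMod_glued_eq_smul_xPlus_of_plane_small hvσ hϖ hd hpr hB hx₀ hx₀1 hprx γ₂ u m hplane,
    latticeValueSetMod_glued_eq_smul_xPlus_of_plane_small hvσ hϖ hd hpr' hB' hx₀' hx₀'1 hprx' γ₂ u m hplane',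
    valueSetMod_lineScalar_eq_of_v_eq σ ϖ d m _ 1 _ hx₀1 hx₀'1]

/-! ## §5 The line coefficient moves the letter: `h ↦ c·h` multiplies the census letter of a line-dominated vertex by `c` -/

/-- **CHANGING THE LINE COEFFICIENT BY A UNIT MULTIPLIES THE LETTER**: for a line-dominated glued vertex (same `M`, `Γ`, plane data), the thickened value set of `Γ − 1` for the block
form `(H₂, c·h)` is `(c·) ''` the one for `(H₂, h)` when `|c| = 1` and the plane part is `ϖ^m`-small (★ p861154 `image_mul_valueSetMod_smul_xPlus`).  With ★ p861154 §2 a `σ`-fixed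
NON-norm `c` therefore EXCHANGES the classes `+ ↔ −′` (the opposite signs of the diagonal cell at the two literals, (β₂-L)). [cite: Serre1979, Ch. V §3 Cor. 3] [cite: Rogawski1990, §4.9 Prop. 4.9.1 (b) p. 55] -/
theorem valueSet_glued_eq_image_mul_of_plane_small {σ : K →+* K} (hvσ : ∀ a, Valued.v (σ a) = Valued.v a) {ϖ : K} (hϖ : Valued.v ϖ = exp (-1 : ℤ)) {d : ℕ}
    (hd : Valued.v (ϖ - σ ϖ) = Valued.v ϖ ^ d) (H₂ : Matrix (Fin 2) (Fin 2) K) (h : K) {c : K} (hc1 : Valued.v c = 1)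
    {M : Submodule 𝒪[K] (Fin 3 → K)} {b : ℕ} (hpr : ∀ x ∈ M, Valued.v (x 1) * Valued.v ϖ ^ b ≤ 1)
    {B₂ : Submodule 𝒪[K] (Fin 2 → K)} {w₀ : Fin 2 → K} {x₀ : Fin 3 → K}
    (hB : B₂.map ((Matrix.toLin' (!![1, 0; 0, 0; 0, 1] : Matrix (Fin 3) (Fin 2) K)).restrictScalars 𝒪[K]) =
      M ⊓ LinearMap.ker ((LinearMap.proj (1 : Fin 3) : (Fin 3 → K) →ₗ[K] K).restrictScalars 𝒪[K]))
    (hx₀ : x₀ ∈ M) (hx₀1 : Valued.v (x₀ 1) * Valued.v ϖ ^ b = 1) (hprx : x₀ - Pi.single 1 (x₀ 1) = ![w₀ 0, 0, w₀ 1])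
    (γ₂ : GL (Fin 2) K) (u : GL (Fin 1) K) (m : ℕ)
    (hplane : ∀ β ∈ B₂, ∀ a : K, Valued.v a ≤ 1 →
      Valued.v ((ϖ ^ m)⁻¹ * (pairing σ H₂ (β + a • w₀) ((((γ₂ : Matrix (Fin 2) (Fin 2) K) - (u : Matrix (Fin 1) (Fin 1) K) 0 0 • (1 : Matrix (Fin 2) (Fin 2) K))) *ᵥ (β + a • w₀)) +
        ((u : Matrix (Fin 1) (Fin 1) K) 0 0 - 1) * pairing σ H₂ (β + a • w₀) (β + a • w₀))) ≤ 1) :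
    {z : K | ∃ y ∈ M, Valued.v ((ϖ ^ m)⁻¹ * (z - pairing σ (!![H₂ 0 0, 0, H₂ 0 1; 0, c * h, 0; H₂ 1 0, 0, H₂ 1 1] : Matrix (Fin 3) (Fin 3) K) y
        ((((endoGL (γ₂, u) : GL (Fin 3) K) : Matrix (Fin 3) (Fin 3) K) - 1) *ᵥ y))) ≤ 1} =
      (fun z => c * z) '' {z : K | ∃ y ∈ M, Valued.v ((ϖ ^ m)⁻¹ * (z - pairing σ (!![H₂ 0 0, 0, H₂ 0 1; 0, h, 0; H₂ 1 0, 0, H₂ 1 1] : Matrix (Fin 3) (Fin 3) K) y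
        ((((endoGL (γ₂, u) : GL (Fin 3) K) : Matrix (Fin 3) (Fin 3) K) - 1) *ᵥ y))) ≤ 1} := by
  rw [valueSet_glued_eq_smul_xPlus_of_plane_small hvσ hϖ hd H₂ (c * h) hpr hB hx₀ hx₀1 hprx γ₂ u m hplane,
    valueSet_glued_eq_smul_xPlus_of_plane_small hvσ hϖ hd H₂ h hpr hB hx₀ hx₀1 hprx γ₂ u m hplane, image_mul_valueSetMod_smul_xPlus σ ϖ d m _ hc1]
  congr 2
  ring

end Summit.HodgeConjecture.HodgeConjecture.Cruxes.H413.F0P3cDyRamGlueLabelLineDominated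

end
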